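import Summits.BirchSwinnertonDyer.Rank1Residual.GaloisImage.KatoKuriharaWitnessPairOfZetaBody
import Summits.BirchSwinnertonDyer.Rank1Residual.GaloisImage.KolyvaginPrimeOfFrobeniusClassDeep
import Summits.BirchSwinnertonDyer.Rank1Residual.GaloisImage.KatoKuriharaPortThreeWith
import Summits.BirchSwinnertonDyer.Rank1Residual.GaloisImage.PropagatedConditionTopOfNoTorsionThree
import Summits.BirchSwinnertonDyer.Rank1Residual.GaloisImage.TorsionReductionOfLe
import Literature.NumberTheory.EllipticCurves.NonEisensteinPrimeOfSurjective
import HarnessLib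

/-!
# ★ PK-6₂ — PORT″ `KatoKuriharaPortThreeAtWith₂ W 0 v₃ η P` FROM KATO'S EULER SYSTEM, modulo the
# per-level VALUE rows (cell `b2b-bsdres`, team n1011, seat p13 GEN 14 — PK-6 lineage; lead R5-111
# (a)/(γ), R5-113 (a)/(c); joint text (ii-b) + r1 riders (α)(β); ROUTE-1 §58 D-58-1, §60)

HONEST FRAMING (cell `b2b-bsdres`, run/shared/lean/b2b/bsd-rank1-residual/, verbatim in every
file): the goal of the cell is to DELETE the COMBINATION-SHAPED residual classes of the
Birch–Swinnerton-Dyer formula for ALL analytic-rank `≤ 1` elliptic curves over `ℚ` — "full BSD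
formula for every rank `≤ 1` curve in class `C`" assembled STRICTLY from published theorems — so
that the rank-`≤ 1` remainder becomes exactly the CONSTRUCTION-SHAPED classes, which are TYPED
(missing-input `Prop`s), NOT attempted. This is not "finishing BSD". Team n1011 (N10/N11; ROUTE 1,
the PORT anatomy (P-KIM) of class X4 ∧ `p = 3`): research route on CONSTRUCTION-SHAPED classes;
prove what is provable now; no claim beyond stated classes; census output = EVIDENCE, never a
Literature fact; RESIDUAL-MAP marks UNCHANGED; nothing is booked by this file.  THIS IS AN END
THEOREM WITH DISPLAYED HYPOTHESES — it closes NO row by itself: the typed missing-input predicate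
PORT″ (`KatoKuriharaPortThreeAtWith₂`, n1011-p18, flag `K22-Thm3.13-PORT@3`) at `t = 0` is REDUCED
to (a) Kato's cited fact's matrix `ZetaBody` on DISPLAYED witnesses bound for the newform `P.f`
(ROUTE-1 §48.4 socket: never obtained inside an END), (b) the CONSTRUCTION-SHAPED (P-EXP) riders
`KatoExpStarFiniteLevelAt W 3 j 0 v₃ Λ (Λfin j)` at every depth (PK-5; never `_holds`), (c) THEOREM
D's row certificates `hbad` (no `3`-torsion over `ℚ_w` at bad `w ≠ 3`) and `ht0` (none over `ℚ₃`:
`t = 0`), (d) the auxiliary-datum side condition `hcdA` (no prime `≡ 1 (mod 3)` divides `2cdA`, so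
every Kolyvagin prime is a usable prime of Kato's system) with `hN : N = N_E`, and (e) the per-level
VALUE ROWS `hvalue` (the OUT of n1011-p02's T-PK6-VROW on n1011-p15's PK-4b-C — DISPLAYED until they
land; per level they may use that the primes are usable, Kolyvagin of level `j+1` and that `η` is
primitive there — all supplied here from the guards).  0 defs / 0 facts / 0 sorry.

## What and how

`katoKuriharaPortThreeAtWith₂_zero_of_zetaBody : … → KatoKuriharaPortThreeAtWith₂ W 0 v₃ η P`.
Unfold PORT″: for depths `k ≤ k′`, data `D`, `D′` canonical for the SAME `η` (With-guards) and the
pinned reduction `red`, DICT3₂At's antecedents are introduced (`Addv`, `¬3 ∣ c₃`, Manin, period are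
not read — rider (α); `surj(3)` gives `Irr(E[3])`, `hasIrreducibleModPGaloisRep_of_hasSurjectiveModNGaloisRep`);
the guards give THEOREM D's `hT`/`hD`; their class inclusions give `hKol` at levels `k+1`, `k′+1`
(n1011-p13 E1-deep `KolyvaginPrime.isKolyvaginPrime_of_mem_frobeniusClassPrimes_of_le`) and, with
`hcdA` + `hN`, `hPr : 𝒫 ⊆` the usable primes of Kato's system for `(c, d, A, N)`; `ht0` gives
`𝓕_can,3 = ⊤` at every depth (`propagatedSelmerStructure_three_eq_top_of_torsion_eq_zero`, Mazur–Rubin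
Lemma A.1, along the reduction tower `exists_torsionReduction_three`); then n1011-p13's T-PK62-PAIR
`KatoValue.exists_katoKuriharaWitnessAt_pair_of_zetaBody` (D7 + T-PK6-GEN ×2) yields both witness
clause sets and (COMP), packaged diagonally (`κ′ = κ`, `κu′ = κu`).

HONEST LIMITS: `t = 0` only (the `ht` antecedent of DICT3₂At at `t ≥ 1` contradicts `ht0`; those
rows need the T-DER-BP road); rows with a 3-anomalous bad place excluded (`hbad`; END-b); the value
rows are hypotheses; nothing is booked; the 41 PORT-displaying records re-key to PORT″ elsewhere.

References: K. Kato, Astérisque 295 (2004) §9.4, Thm. 9.7, Ex. 13.3 [Kato2004Asterisque]; C.-H. Kim,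
AJM 148 = arXiv:2203.12159, Thm. 3.13, §1.2.2, §2.2.2, §3.3–§3.4.1 [Kim2022StructureSelmer]; B. Mazur,
K. Rubin, Mem. AMS 799 (2004), Def. 3.1.3, Thm. 3.2.4, App. A [MazurRubin2004]; R. Sakamoto, JTNB 36
(2024) §2, Def. 4.1 [Sakamoto2024]; K. Rubin, *Euler Systems* (2000) Def. 4.4.4 [Rubin2000]; design
`cells/n1011/ROUTE-1.md` §56.3 (B), §58, §60; lead R5-110 (k), R5-111, R5-112 (a), R5-113 (a)(c);
`cells/n1011/skel/T-PORT-1-PKIM.md` v0.8 (28).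
-/

noncomputable section

open scoped NumberField TensorProduct ContRepresentation Classical
open CategoryTheory Field Function Finset IsDedekindDomain NumberField WeierstrassCurve
open Rat.HeightOneSpectrum
open Literature.NumberTheory.GaloisRepresentations Literature.NumberTheory.GaloisCohomology
open Literature.NumberTheory.GaloisRepresentations.DiscreteGaloisModule
open Literature.NumberTheory.EllipticCurves Literature.NumberTheory.EllipticCurves.ModularForms
open Literature.NumberTheory.EllipticCurves.Kato2004
open Literature.NumberTheory.EllipticCurves.Kato2004.EulerSystemValues

namespace Summit.BirchSwinnertonDyer.Rank1Residual.GaloisImage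

variable (W : WeierstrassCurve ℚ) [W.IsElliptic] [W.IsGloballyMinimal]
  [ContinuousSMul ℤ_[3] (W.tateModule 3)] [Module.Free ℤ_[3] (W.tateModule 3)]
  [Module.Finite ℤ_[3] (W.tateModule 3)]

/-- Local notation: `𝐃F⟦r, τ⟧ ℓ = Σ_{j<ℓ−1} j·σ_{χ_{m(0,r)}(τ_ℓ)}^j` on the level field `ℚ(ζ_{m(0,r)})`
(PK-1 ★2's field-side spelling, `p = 3`). -/
local notation3 (prettyPrint := false) "𝐃F⟦" r ", " τ "⟧" =>
  fun ℓ : HeightOneSpectrum (𝓞 ℚ) =>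
  ∑ j ∈ Finset.range (((primesEquiv ℓ : Nat.Primes) : ℕ) - 1),
    (j : Module.End ℚ (CyclotomicField (cycLevel 3 0 r) ℚ)) *
      (sigma (cycLevel 3 0 r) (modNCyclotomicCharacter ℚ (cycLevel 3 0 r)
          ((τ : HeightOneSpectrum (𝓞 ℚ) → absoluteGaloisGroup ℚ) ℓ)) :
        CyclotomicField (cycLevel 3 0 r) ℚ →ₐ[ℚ] CyclotomicField (cycLevel 3 0 r) ℚ).toLinearMap ^ j

set_option backward.isDefEq.respectTransparency false in
/-- **★ PK-6₂: PORT″ at `t = 0` from Kato's Euler system, THEOREM D, the riders and the value rows**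
(module docstring).  Displayed: the parametrisation datum `P` at the conductor level (`hN`), Kato's
witnesses through `hbody` for `P.f`, the rider family `hfin`, `hcdA`, THEOREM D's certificates
`hbad` / `ht0`, the value rows `hvalue`; concluded: `KatoKuriharaPortThreeAtWith₂ W 0 v₃ η P` for
every place `v₃` and every generator family `η`.
[cite: Kato2004Asterisque, §9.4 (p. 188), Thm. 9.7 (p. 189) and Ex. 13.3 (pp. 224–225)]
[cite: Kim2022StructureSelmer, Thm. 3.13 and §1.2.2, §2.2.2, §3.3–§3.4.1 (arXiv v3 pp. 12, 17–18, 26–27)]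
[cite: MazurRubin2004, Def. 3.1.3, Thm. 3.2.4 and App. A (Lemma A.1)] [cite: Sakamoto2024, §2 and Def. 4.1] -/
theorem katoKuriharaPortThreeAtWith₂_zero_of_zetaBody
    {N : ℕ} [NeZero N] (P : ModularParametrizationData W N) (hN : N = W.conductorNorm ℤ)
    {ι : (n : ℕ) → (CyclotomicField n ℚ →+* ℂ)} {κK : ℝ}
    {Λ : ∀ (k' : ℕ) (r : Finset (HeightOneSpectrum (𝓞 ℚ))),
      H1 (tateRep W 3) (cycSubgroup 3 k' r) →ₗ[ℤ_[3]] ℚ_[3] ⊗[ℚ] CyclotomicField (cycLevel 3 k' r) ℚ}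
    {c d a : ℤ} {A : ℕ}
    {z : ∀ (k' : ℕ) (r : (cyclotomicLevelsRat 3 (badPlaces c d A N)).Ideals),
      H1 (tateRep W 3) ((cyclotomicLevelsRat 3 (badPlaces c d A N)).level k' r.1)}
    {x : ∀ (k' : ℕ) (r : (cyclotomicLevelsRat 3 (badPlaces c d A N)).Ideals),
      CyclotomicField (cycLevel 3 k' r.1) ℚ}
    (hbody : ZetaBody W 3 P.f ι κK Λ c d a A z x)
    {v₃ : HeightOneSpectrum (𝓞 ℚ)}
    (Λfin : ∀ j : ℕ, galoisCohomology ((W.torsionGaloisModule (((3 : ℕ) : ℤ) ^ j * ((3 : ℕ) : ℤ))).toLocal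
      (Sum.inr v₃)) 1 →+ ZMod (3 ^ (j + 1)))
    (hfin : ∀ j : ℕ, KatoExpStarFiniteLevelAt W 3 j 0 v₃ Λ (Λfin j))
    {η : (q : HeightOneSpectrum (𝓞 ℚ)) → (ZMod (Ideal.absNorm q.asIdeal))ˣ}
    -- the auxiliary datum avoids every prime `≡ 1 (mod 3)` (so every Kolyvagin prime is usable)
    (hcdA : ∀ q : ℕ, q.Prime → q ≡ 1 [MOD 3] → ¬ q ∣ 2 * c.natAbs * d.natAbs * A)
    -- THEOREM D's row certificates
    (hbad : ∀ w : HeightOneSpectrum (𝓞 ℚ), ¬ W.HasGoodReductionAt w →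
      ((primesEquiv w : Nat.Primes) : ℕ) ≠ 3 →
        ∀ Q : (W.baseChange (w.adicCompletion ℚ)).toAffine.Point, 3 • Q = 0 → Q = 0)
    (ht0 : ∀ w : HeightOneSpectrum (𝓞 ℚ), ((3 : ℕ) : 𝓞 ℚ) ∈ w.asIdeal →
        ∀ Q : (W.baseChange (w.adicCompletion ℚ)).toAffine.Point, 3 • Q = 0 → Q = 0)
    -- the per-level VALUE ROWS (T-PK6-VROW's OUT), displayed
    (hvalue : ∀ (j : ℕ) (σ : HeightOneSpectrum (𝓞 ℚ) → absoluteGaloisGroup ℚ),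
      (∀ q, σ q ∈ (adicCompletionPrime ℚ q).inertia (absoluteGaloisGroup ℚ)) →
      (∀ q, modNCyclotomicCharacter ℚ (Ideal.absNorm q.asIdeal) (σ q) = η q) →
      ∀ (r : Finset (HeightOneSpectrum (𝓞 ℚ)))
        (hr : ∀ q ∈ r, q ∈ (cyclotomicLevelsRat 3 (badPlaces c d A N)).primes),
        (∀ q ∈ r, Kato.IsKolyvaginPrime W 3 (j + 1) ((primesEquiv q : Nat.Primes) : ℕ)) →
        (∀ q ∈ r, Subgroup.zpowers (η q) = ⊤) →
        ∃ (s : ℤ_[3]) (u : (ZMod (3 ^ (j + 1)))ˣ)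
          (ψ : (ℓ : ℕ) → (ZMod ℓ)ˣ →* Multiplicative (ZMod (3 ^ (j + 1)))),
          (∀ q ∈ r, Function.Surjective (ψ (Ideal.absNorm q.asIdeal))) ∧
          (∃ l ∈ cycIntLattice 3 (cycLevel 3 0 r),
            (((3 : ℕ) : ℤ_[3]) ^ (0 : ℕ)) • ((1 : ℚ_[3]) ⊗ₜ[ℚ]
              ((r.noncommProd 𝐃F⟦r, σ⟧ (ZetaValue.pairwise_commute_fieldDeriv (cycLevel 3 0 r)
                  (fun ℓ => modNCyclotomicCharacter ℚ (cycLevel 3 0 r) (σ ℓ))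
                  (fun ℓ => ((primesEquiv ℓ : Nat.Primes) : ℕ) - 1) r))
                (x 0 ⟨r, hr⟩ + sigma (cycLevel 3 0 r) (-1) (x 0 ⟨r, hr⟩)))) -
              ((s : ℚ_[3]) ⊗ₜ[ℚ] (1 : CyclotomicField (cycLevel 3 0 r) ℚ)) =
            (((3 : ℕ) : ℤ_[3]) ^ (j + 1)) • (l : ℚ_[3] ⊗[ℚ] CyclotomicField (cycLevel 3 0 r) ℚ)) ∧
          haveI : NeZero (∏ q ∈ r, Ideal.absNorm q.asIdeal) :=
            ⟨Finset.prod_ne_zero_iff.2 fun q _ h => q.ne_bot (Ideal.absNorm_eq_zero_iff.1 h)⟩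
          PadicInt.toZModPow (j + 1) s = (u : ZMod (3 ^ (j + 1))) *
            ((3 : ℕ) : ZMod (3 ^ (j + 1))) ^ (0 : ℕ) *
              kuriharaNumber P.f (3 ^ (j + 1)) (∏ q ∈ r, Ideal.absNorm q.asIdeal) ψ) :
    KatoKuriharaPortThreeAtWith₂ W 0 v₃ η P := by
  intro k k' D D' red hDW hDW' hkk' hred _hadd _hc3 hsurj _ht hv₃ _hcP _hper
  -- the guards
  obtain ⟨hT, hC, S, τ, hS, hτμ, hτq, hP⟩ := hDW
  obtain ⟨hT', hC', S', τ', hS', hτμ', hτq', hP'⟩ := hDW'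
  have hirr : W.HasIrreducibleModPGaloisRep 3 :=
    hasIrreducibleModPGaloisRep_of_hasSurjectiveModNGaloisRep W 3 hsurj
  -- Kolyvagin primes of the right levels (E1-deep on the deep classes of the guards)
  have hKol : ∀ q ∈ D.primes, Kato.IsKolyvaginPrime W 3 (k + 1) ((primesEquiv q : Nat.Primes) : ℕ) :=
    fun q hq => KolyvaginPrime.isKolyvaginPrime_of_mem_frobeniusClassPrimes_of_le W
      (Nat.le_add_right k 0) (fun v hv => (hS v hv).1) hτμ hτq (hP hq)
  have hKol' : ∀ q ∈ D'.primes, Kato.IsKolyvaginPrime W 3 (k' + 1) ((primesEquiv q : Nat.Primes) : ℕ) :=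
    fun q hq => KolyvaginPrime.isKolyvaginPrime_of_mem_frobeniusClassPrimes_of_le W
      (Nat.le_add_right k' 0) (fun v hv => (hS' v hv).1) hτμ' hτq' (hP' hq)
  -- every Kolyvagin prime is a usable prime of Kato's system for `(c, d, A, N)`
  have husable : ∀ (j : ℕ) (q : HeightOneSpectrum (𝓞 ℚ)),
      Kato.IsKolyvaginPrime W 3 (j + 1) ((primesEquiv q : Nat.Primes) : ℕ) →
        q ∈ (cyclotomicLevelsRat 3 (badPlaces c d A N)).primes := by
    intro j q hq
    have hℓ := hq.prime
    have h13 : ((primesEquiv q : Nat.Primes) : ℕ) ≡ 1 [MOD 3] :=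
      hq.modEq_one.of_dvd (dvd_pow_self 3 (Nat.succ_ne_zero j))
    refine (mem_primes_cyclotomicLevelsRat_badPlaces_iff 3 c d A N q).2 ⟨fun hdvd => ?_, hq.ne⟩
    rcases (Nat.Prime.dvd_mul hℓ).mp hdvd with h | h
    · exact hcdA _ hℓ h13 h
    · apply hq.not_dvd
      rw [← hN]
      exact dvd_mul_of_dvd_left h 3
  have hPr : D.primes ⊆ (cyclotomicLevelsRat 3 (badPlaces c d A N)).primes :=
    fun q hq => husable k q (hKol q hq)
  have hPr' : D'.primes ⊆ (cyclotomicLevelsRat 3 (badPlaces c d A N)).primes :=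
    fun q hq => husable k' q (hKol' q hq)
  -- `𝓕_can,3 = ⊤` at every depth (`t = 0`, Mazur–Rubin Lemma A.1 along the reduction tower)
  have htower : ∀ j : ℕ,
      ∃ redj : (W.torsionGaloisModule (((3 : ℕ) : ℤ) ^ (j + 1) * ((3 : ℕ) : ℤ))).toContRepresentation →ⁱL
          (W.torsionGaloisModule (((3 : ℕ) : ℤ) ^ j * ((3 : ℕ) : ℤ))).toContRepresentation,
        ∀ y : geomTorsion W (((3 : ℕ) : ℤ) ^ (j + 1) * ((3 : ℕ) : ℤ)),
          ((redj y : geomTorsion W (((3 : ℕ) : ℤ) ^ j * ((3 : ℕ) : ℤ))) : geomPoints W) =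
            ((3 : ℕ) : ℤ) • (y : geomPoints W) := by
    intro j
    obtain ⟨redj, hredj⟩ := exists_torsionReduction_three W j (j + 1)
    refine ⟨redj, fun y => ?_⟩
    rw [hredj, Nat.add_sub_cancel_left, pow_one]
  choose redT hredT using htower
  have htop : ∀ (j : ℕ) (w : HeightOneSpectrum (𝓞 ℚ)), ((primesEquiv w : Nat.Primes) : ℕ) = 3 →
      propagatedSelmerStructure W 3 j (Sum.inr w) = ⊤ := by
    intro j w hw
    have hw3 : ((3 : ℕ) : 𝓞 ℚ) ∈ w.asIdeal := KolyvaginPrime.natCast_mem_asIdeal_of_primesEquiv_eq hw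
    exact propagatedSelmerStructure_three_eq_top_of_torsion_eq_zero W w hw3 (ht0 w hw3) redT hredT j
  -- the witness package at the two depths + (COMP) (T-PK62-PAIR), value rows from `hvalue`
  obtain ⟨κf, κu, h₁, h₂, h₃⟩ :=
    KatoValue.exists_katoKuriharaWitnessAt_pair_of_zetaBody W P hbody hirr hkk' red hred hv₃
      (hfin k) (hfin k') D hT D' hT' hC hC' hPr hPr' hKol hKol' hbad (htop k) (htop k')
      (fun σ hI hχ r hr => hvalue k σ hI hχ r (fun q hq => hPr (hr (Finset.mem_coe.2 hq)))
        (fun q hq => hKol q (hr (Finset.mem_coe.2 hq)))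
        (fun q hq => hC.zpowers_eq_top (hr (Finset.mem_coe.2 hq))))
      (fun σ hI hχ r hr => hvalue k' σ hI hχ r (fun q hq => hPr' (hr (Finset.mem_coe.2 hq)))
        (fun q hq => hKol' q (hr (Finset.mem_coe.2 hq)))
        (fun q hq => hC'.zpowers_eq_top (hr (Finset.mem_coe.2 hq))))
  exact ⟨κf, Λfin k, κf, κu, Λfin k', κu, h₁, h₂, fun e he' he => ⟨h₃ e he' he, h₃ e he' he⟩⟩

end Summit.BirchSwinnertonDyer.Rank1Residual.GaloisImage

end
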